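import Summits.Ventures.LatticeQCDFlow.Scoring.VarianceOfTheMean

/-!
# The sample autocovariances of ANY series sum to zero: why the Γ-method must truncate its window

HONEST FRAMING: exact (Metropolis-corrected) sampling algorithms for lattice gauge theory;
figures of merit are autocorrelation/cost numbers at stated couplings and volumes; no
continuum-physics claim.

Venture `LatticeQCDFlow` (cell pub-lqcd), sub-topic `Scoring`; FANOUT row 11 (`eng-scorerA`,
fitness scorer A).  NEW WORK of the cell in the sense of the placement rule (finite sums, our own
proof); the fact is known — Percival, *Three curious properties of the sample variance and
autocovariance for stationary processes with unknown mean*, The American Statistician 47 (1993)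
274–276, property 1 — and is named here, not cited as a tree fact.

## What the frozen scorer computes

Scorer A 0.1.2's Γ-method (`scorerA/gamma.py`, Wolff 2004 §3.1) forms, for one stream of `N`
samples with sample mean `x̄`, the lag sums `S(t) = Σ_{i < N−t} (xᵢ − x̄)(x_{i+t} − x̄)`
(`_autocov_sums`), the autocovariance estimate `Γ̂(t) = S(t)/(N − t)` (`gamma_function`), the
normalised `ρ̂(t) = Γ̂(t)/Γ̂(0)`, and the WINDOWED `τ̂_W = 1/2 + Σ_{t=1}^{W} ρ̂(t)`
(`tau_int_W`, = `CalibrationTruths.tauIntWindow ρ̂ W`) at an automatically chosen `W ≪ N`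
(`_auto_window`), plus a diagnostic `tau_long` at a long window `W_L ≤ N/2`.

## Content (every real series `x₀ … x_{N−1}`; no probability, no stationarity)

* `sum_sum_mul_eq_diag_add_lags` — the pair split: `Σ_{i,j<N} dᵢ dⱼ = Σ_{i<N} dᵢ² + 2 Σ_{t=1}^{N} S_d(t)`
  with `S_d(t) = Σ_{i<N−t} dᵢ d_{i+t}` (`S_d(N) = 0`, empty sum);
* `sum_dev_eq_zero` — deviations from the sample mean sum to zero, so the left side vanishes for
  `d = x − x̄`: **`acovSum_zero_add_two_mul_sum_eq_zero`: `S(0) + 2 Σ_{t=1}^{N} S(t) = 0`**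
  (Percival's property 1), i.e. `Σ_{t ≥ 1} S(t) = −S(0)/2` (`sum_acovSum_succ_eq`);
* `exists_acovSum_succ_neg` — hence the empirical autocovariance of every non-constant series is
  NEGATIVE at some lag `1 ≤ t < N`, whatever the true autocorrelation (a positively correlated AR(1)
  included): the long-lag tail of `ρ̂` is not small noise around a positive truth but is pinned by an
  exact constraint;
* `fejerWeight_mul_rhoHat` — with scorer A's normalisation, `(1 − t/N) ρ̂(t) = S(t)/S(0)`; so
  **`tauIntN_rhoHat_eq_zero`: the plug-in value of the finite-`N` integrated autocorrelation time
  `τ_N` of `Scoring/VarianceOfTheMean` (there: `Var(x̄_N) = 2 τ_N σ²/N` EXACTLY in population) is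
  IDENTICALLY ZERO on every data set**: the variance of the mean cannot be estimated from one series
  without truncating the lag sum — the window `W` is what makes `τ̂` an estimator at all, not a
  refinement of one; and `tauIntWindow_rhoHat_full` — the UNWEIGHTED full-range window
  `τ̂_{W=N} = (1/N) Σ_{t≤N} t ρ̂(t)` is nothing but the Fejér correction term (pure long-lag noise,
  each `ρ̂(t)` carrying weight `t/N`).

Reading for the record: on row 21's SU(3) P0/E1 fine stream (N = 1 200, RESCORE-A-su3base-P0E1-fine)
scorer A printed `tau_long = −2.23` for `Q` at `W_long = 600 = N/2` next to `τ̂_int = 9.7 ± 3.0` at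
`W_opt = 38`: a negative 'integrated autocorrelation time' at a long window is this identity at work,
not evidence about the chain; the automatic window (`Scoring/WolffWindow`) exists precisely to stop
far short of the constrained tail.

What is NOT here: the size of the induced bias at the CHOSEN window (population statement
`E τ̂_W ≈ τ_W − (2W+1) τ_int/N` to leading order — a calibration matter, CALIBRATION-A of record) and
anything about replica pooling (`R > 1` streams shift the constraint to the pooled mean).
-/

namespace Summit.Ventures.LatticeQCDFlow.Scoring

open Finset
open scoped BigOperators

/-! ### The pair split by lag (any real sequence) -/

/-- Lag sums of a sequence `d`: `lagSum d N t = Σ_{i < N − t} dᵢ d_{i+t}` (scorer A `_autocov_sums`;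
`t ≥ N` gives the empty sum `0`). -/
def lagSum (d : ℕ → ℝ) (N t : ℕ) : ℝ :=
  ∑ i ∈ range (N - t), d i * d (i + t)

/-- `lagSum d N 0 = Σ_{i<N} dᵢ²`. -/
theorem lagSum_zero (d : ℕ → ℝ) (N : ℕ) : lagSum d N 0 = ∑ i ∈ range N, d i ^ 2 := by
  unfold lagSum
  simp only [Nat.sub_zero, add_zero, sq]

/-- Beyond the series the lag sum is empty: `lagSum d N N = 0`. -/
theorem lagSum_self (d : ℕ → ℝ) (N : ℕ) : lagSum d N N = 0 := by
  unfold lagSum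
  simp

/-- Growing the series by one sample adds, at each lag `t+1 ≤ N`, the single new pair that ends at
the new point: `lagSum d (N+1) (t+1) = lagSum d N (t+1) + d_{N−1−t} · d_N` for `t < N`. -/
theorem lagSum_succ_succ (d : ℕ → ℝ) {N t : ℕ} (ht : t < N) :
    lagSum d (N + 1) (t + 1) = lagSum d N (t + 1) + d (N - 1 - t) * d N := by
  unfold lagSum
  have h1 : N + 1 - (t + 1) = N - (t + 1) + 1 := by omega
  rw [h1, Finset.sum_range_succ,
    show N - (t + 1) + (t + 1) = N from by omega,
    show N - (t + 1) = N - 1 - t from by omega]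

/-- **Pair split by lag.**  For every real sequence and every `N`:
`Σ_{i<N} Σ_{j<N} dᵢ dⱼ = Σ_{i<N} dᵢ² + 2 Σ_{t<N} lagSum d N (t+1)` — `N` diagonal pairs and, at
each lag `t+1`, `N − (t+1)` ordered pairs counted twice (`lagSum d N N = 0` closes the range). -/
theorem sum_sum_mul_eq_diag_add_lags (d : ℕ → ℝ) : ∀ N : ℕ,
    ∑ i ∈ range N, ∑ j ∈ range N, d i * d j
      = ∑ i ∈ range N, d i ^ 2 + 2 * ∑ t ∈ range N, lagSum d N (t + 1)
  | 0 => by simp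
  | N + 1 => by
    have IH := sum_sum_mul_eq_diag_add_lags d N
    -- the lag part grows by d_N · Σ_{i<N} d_i
    have hlag : ∑ t ∈ range (N + 1), lagSum d (N + 1) (t + 1)
        = ∑ t ∈ range N, lagSum d N (t + 1) + d N * ∑ i ∈ range N, d i := by
      rw [Finset.sum_range_succ, lagSum_self, add_zero]
      have hsplit : ∀ t ∈ range N,
          lagSum d (N + 1) (t + 1) = lagSum d N (t + 1) + d (N - 1 - t) * d N :=
        fun t ht => lagSum_succ_succ d (mem_range.mp ht)
      rw [Finset.sum_congr rfl hsplit, Finset.sum_add_distrib,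
        Finset.sum_range_reflect (fun i => d i * d N) N, ← Finset.sum_mul, mul_comm]
    -- the square part grows by d_N · Σ_{i<N} d_i twice plus d_N²
    rw [Finset.sum_range_succ, hlag]
    simp_rw [Finset.sum_range_succ]
    rw [Finset.sum_add_distrib, IH, ← Finset.sum_mul]
    have hcomm : ∑ i ∈ range N, d N * d i = d N * ∑ i ∈ range N, d i := by
      rw [Finset.mul_sum]
    rw [hcomm]
    ring

/-! ### Deviations from the sample mean: the sum rule -/

/-- The sample mean `x̄ = (1/N) Σ_{i<N} xᵢ`. -/
noncomputable def sampleMean (x : ℕ → ℝ) (N : ℕ) : ℝ :=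
  (∑ i ∈ range N, x i) / N

/-- Deviations from the sample mean, `dᵢ = xᵢ − x̄`. -/
noncomputable def dev (x : ℕ → ℝ) (N : ℕ) (i : ℕ) : ℝ :=
  x i - sampleMean x N

/-- The lag sums of scorer A: `acovSum x N t = S(t) = Σ_{i<N−t} (xᵢ − x̄)(x_{i+t} − x̄)`. -/
noncomputable def acovSum (x : ℕ → ℝ) (N t : ℕ) : ℝ :=
  lagSum (dev x N) N t

/-- Deviations from the sample mean sum to zero (`N ≥ 1`). -/
theorem sum_dev_eq_zero (x : ℕ → ℝ) {N : ℕ} (hN : N ≠ 0) :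
    ∑ i ∈ range N, dev x N i = 0 := by
  have hN' : (N : ℝ) ≠ 0 := by exact_mod_cast hN
  unfold dev sampleMean
  rw [Finset.sum_sub_distrib, Finset.sum_const, Finset.card_range, nsmul_eq_mul]
  field_simp
  ring

/-- `S(0) = Σ (xᵢ − x̄)² ≥ 0`. -/
theorem acovSum_zero_eq (x : ℕ → ℝ) (N : ℕ) :
    acovSum x N 0 = ∑ i ∈ range N, dev x N i ^ 2 :=
  lagSum_zero _ _

/-- `S(0) ≥ 0`. -/
theorem acovSum_zero_nonneg (x : ℕ → ℝ) (N : ℕ) : 0 ≤ acovSum x N 0 := by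
  rw [acovSum_zero_eq]
  exact Finset.sum_nonneg fun i _ => sq_nonneg _

/-- **Percival's property 1 (the sum rule).**  For EVERY real series `x₀ … x_{N−1}`, `N ≥ 1`:
`S(0) + 2 Σ_{t<N} S(t+1) = 0` — the mean-subtracted lag sums over all lags cancel exactly,
because their total is `(Σᵢ (xᵢ − x̄))² = 0`. -/
theorem acovSum_zero_add_two_mul_sum_eq_zero (x : ℕ → ℝ) {N : ℕ} (hN : N ≠ 0) :
    acovSum x N 0 + 2 * ∑ t ∈ range N, acovSum x N (t + 1) = 0 := by
  have h := sum_sum_mul_eq_diag_add_lags (dev x N) N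
  have hsq : ∑ i ∈ range N, ∑ j ∈ range N, dev x N i * dev x N j
      = (∑ i ∈ range N, dev x N i) ^ 2 := by
    rw [sq, Finset.sum_mul_sum]
  rw [hsq, sum_dev_eq_zero x hN] at h
  unfold acovSum
  rw [lagSum_zero]
  linarith [h]

/-- Equivalently `Σ_{t<N} S(t+1) = −S(0)/2`: the off-diagonal lag sums of any series total MINUS
half the sum of squares. -/
theorem sum_acovSum_succ_eq (x : ℕ → ℝ) {N : ℕ} (hN : N ≠ 0) :
    ∑ t ∈ range N, acovSum x N (t + 1) = -(acovSum x N 0) / 2 := by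
  have h := acovSum_zero_add_two_mul_sum_eq_zero x hN
  linarith

/-- **Every non-constant series has a negative sample autocovariance at some lag `1 ≤ t+1 ≤ N−1`**
(the lag-`N` sum is empty, so the witness is a genuine lag `< N`), whatever the sign of the true
autocorrelation. -/
theorem exists_acovSum_succ_neg (x : ℕ → ℝ) {N : ℕ} (hN : N ≠ 0) (hS : 0 < acovSum x N 0) :
    ∃ t, t + 1 < N ∧ acovSum x N (t + 1) < 0 := by
  by_contra hcon
  push Not at hcon
  have hnonneg : ∀ t ∈ range N, 0 ≤ acovSum x N (t + 1) := by
    intro t ht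
    have ht' : t < N := mem_range.mp ht
    rcases Nat.lt_or_ge (t + 1) N with hlt | hge
    · exact hcon t hlt
    · have heq : t + 1 = N := by omega
      rw [heq]
      unfold acovSum
      rw [lagSum_self]
  have hsum : 0 ≤ ∑ t ∈ range N, acovSum x N (t + 1) := Finset.sum_nonneg hnonneg
  rw [sum_acovSum_succ_eq x hN] at hsum
  linarith

/-! ### Scorer A's normalisation and the plug-in `τ_N` -/

/-- Scorer A's autocovariance estimate `Γ̂(t) = S(t)/(N − t)` (`gamma_function`, one stream); the
value at `t ≥ N` is the junk value `0/0 = 0` and is never used (`W ≤ N/2` in the code). -/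
noncomputable def gammaHat (x : ℕ → ℝ) (N t : ℕ) : ℝ :=
  acovSum x N t / ((N - t : ℕ) : ℝ)

/-- The normalised sample autocorrelation `ρ̂(t) = Γ̂(t)/Γ̂(0)`. -/
noncomputable def rhoHat (x : ℕ → ℝ) (N t : ℕ) : ℝ :=
  gammaHat x N t / gammaHat x N 0

/-- `Γ̂(0) = S(0)/N`. -/
theorem gammaHat_zero (x : ℕ → ℝ) (N : ℕ) : gammaHat x N 0 = acovSum x N 0 / N := by
  unfold gammaHat
  simp

/-- `ρ̂(0) = 1` for a non-constant series. -/
theorem rhoHat_zero (x : ℕ → ℝ) {N : ℕ} (hN : N ≠ 0) (hS : acovSum x N 0 ≠ 0) :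
    rhoHat x N 0 = 1 := by
  have hN' : (N : ℝ) ≠ 0 := by exact_mod_cast hN
  unfold rhoHat
  rw [gammaHat_zero]
  exact div_self (div_ne_zero hS hN')

/-- **The Fejér weight undoes scorer A's `1/(N − t)` normalisation:**
`(1 − (t+1)/N) · ρ̂(t+1) = S(t+1)/S(0)` for every `t < N` (at `t+1 = N` both sides are `0`). -/
theorem fejerWeight_mul_rhoHat (x : ℕ → ℝ) {N t : ℕ} (hN : N ≠ 0) (ht : t < N)
    (hS : acovSum x N 0 ≠ 0) :
    (1 - ((t : ℝ) + 1) / N) * rhoHat x N (t + 1) = acovSum x N (t + 1) / acovSum x N 0 := by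
  have hN' : (N : ℝ) ≠ 0 := by exact_mod_cast hN
  unfold rhoHat gammaHat
  simp only [Nat.sub_zero]
  rcases Nat.lt_or_ge (t + 1) N with hlt | hge
  · have hpos : ((N - (t + 1) : ℕ) : ℝ) ≠ 0 := by
      have : 0 < N - (t + 1) := by omega
      exact_mod_cast this.ne'
    have hcast : ((N - (t + 1) : ℕ) : ℝ) = (N : ℝ) - (t + 1) := by
      rw [Nat.cast_sub hlt.le]
      push_cast
      ring
    rw [hcast] at hpos ⊢
    field_simp
  · have heq : t + 1 = N := by omega
    have hzero : acovSum x N (t + 1) = 0 := by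
      rw [heq]; unfold acovSum; exact lagSum_self _ _
    rw [hzero]
    have hc : ((t : ℝ) + 1) = N := by exact_mod_cast heq
    have hw : (1 - ((t : ℝ) + 1) / N) = 0 := by rw [hc, div_self hN', sub_self]
    rw [hw]
    simp

/-- **The plug-in `τ_N` is identically zero.**  For every non-constant real series of length
`N ≥ 1`, the finite-`N` integrated autocorrelation time of `Scoring/VarianceOfTheMean`
(`τ_N(ρ) = 1/2 + Σ_{t=1}^{N} (1 − t/N) ρ(t)`, for which `Var(x̄_N) = 2 τ_N(ρ) σ²/N` holds EXACTLY
in population) evaluated at the series' own sample autocorrelation `ρ̂` is `0`: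
`τ_N(ρ̂) = 1/2 + Σ_t S(t)/S(0) = 1/2 − 1/2`.  The variance of the mean is not estimable from one
series without a truncated window (or replicas). -/
theorem tauIntN_rhoHat_eq_zero (x : ℕ → ℝ) {N : ℕ} (hN : N ≠ 0) (hS : acovSum x N 0 ≠ 0) :
    tauIntN (rhoHat x N) N = 0 := by
  unfold tauIntN
  have hterm : ∀ t ∈ range N,
      (1 - ((t : ℝ) + 1) / N) * rhoHat x N (t + 1) = acovSum x N (t + 1) / acovSum x N 0 :=
    fun t ht => fejerWeight_mul_rhoHat x hN (mem_range.mp ht) hS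
  rw [Finset.sum_congr rfl hterm, ← Finset.sum_div, sum_acovSum_succ_eq x hN]
  field_simp
  ring

/-- The UNWEIGHTED full-range window is the bare Fejér correction: since `τ_N(ρ̂) = 0`,
`τ̂_{W=N} = tauIntWindow ρ̂ N = (1/N) Σ_{t<N} (t+1) ρ̂(t+1)` — each long-lag `ρ̂(t)` entering with
weight `t/N`, i.e. the noisiest lags weighted most.  (`VarianceOfTheMean.tauIntWindow_sub_tauIntN`.) -/
theorem tauIntWindow_rhoHat_full (x : ℕ → ℝ) {N : ℕ} (hN : N ≠ 0) (hS : acovSum x N 0 ≠ 0) :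
    tauIntWindow (rhoHat x N) N = (∑ t ∈ range N, ((t : ℝ) + 1) * rhoHat x N (t + 1)) / N := by
  have h := tauIntWindow_sub_tauIntN (rhoHat x N) N
  rw [tauIntN_rhoHat_eq_zero x hN hS, sub_zero] at h
  exact h

/-- The scorer's windowed statistic IS `tauIntWindow ρ̂ W` (`tau_int_W[W] = C(W)/(2 Γ̂(0))` with
`C(W) = Γ̂(0) + 2 Σ_{t≤W} Γ̂(t)`), recorded as the identity
`Γ̂(0) · (2 τ_W(ρ̂)) = Γ̂(0) + 2 Σ_{t<W} Γ̂(t+1)` for a non-constant series. -/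
theorem gammaHat_mul_two_mul_tauIntWindow (x : ℕ → ℝ) {N : ℕ} (hN : N ≠ 0)
    (hS : acovSum x N 0 ≠ 0) (W : ℕ) :
    gammaHat x N 0 * (2 * tauIntWindow (rhoHat x N) W)
      = gammaHat x N 0 + 2 * ∑ t ∈ range W, gammaHat x N (t + 1) := by
  have hN' : (N : ℝ) ≠ 0 := by exact_mod_cast hN
  have hG : gammaHat x N 0 ≠ 0 := by
    rw [gammaHat_zero]; exact div_ne_zero hS hN'
  unfold tauIntWindow rhoHat
  have key : gammaHat x N 0 * ∑ t ∈ range W, gammaHat x N (t + 1) / gammaHat x N 0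
      = ∑ t ∈ range W, gammaHat x N (t + 1) := by
    rw [Finset.mul_sum]
    refine Finset.sum_congr rfl fun t _ => ?_
    field_simp
  calc gammaHat x N 0 * (2 * (1 / 2 + ∑ t ∈ range W, gammaHat x N (t + 1) / gammaHat x N 0))
      = gammaHat x N 0
          + 2 * (gammaHat x N 0 * ∑ t ∈ range W, gammaHat x N (t + 1) / gammaHat x N 0) := by
        ring
    _ = gammaHat x N 0 + 2 * ∑ t ∈ range W, gammaHat x N (t + 1) := by rw [key]

end Summit.Ventures.LatticeQCDFlow.Scoring
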